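import Literature.NumberTheory.Automorphic.ArthurClozelWeakLiftingOffS
import HarnessLib

/-!
# Arthur–Clozel, Ch. 3, (4.1) = (4.2) in the LIFTING direction, off a prescribed finite set of
# places — named fact

Topic `NumberTheory/Automorphic`; namespace `Literature.NumberTheory.Automorphic`.

This module vends ONE closed named fact, `ArthurClozel1989_liftingIdentity_heckeCharacters`: the
raw output of the comparison of the trace formula of `GL_n(𝔸_F)` with the twisted trace formula of
`GL_n(𝔸_E) ⋊ σ` for a cyclic extension `E/F` of prime degree (Arthur–Clozel, *Simple algebras, base
change, and the advanced theory of the trace formula*, Ch. 2, Thms. A, B and (17.8); Ch. 3, (4.1) =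
(4.2) and the proof of Thm. 4.2 (a), pp. 203–205), started from a CUSPIDAL `π` of `GL_n(𝔸_F)`
unramified off a prescribed finite set `S` (containing the places ramified in `E`), as an identity
of finitely many characters of the unramified Hecke algebra `ℋ_E^S` with complex coefficients:
on the twisted side characters `χ_{Tᵢ}` attached to isobaric data over `E` (Langlands 1979, Prop. 2:
ranks `k_{i,m} ≥ 1` with `∑ₘ k_{i,m} = n`, cuspidal `Π_{i,m}`, complex shifts `s_{i,m}` with
`∑ₘ k_{i,m} s_{i,m} = 0`, Satake families `A_{i,m}` off the places over `S`), on the `GL_n(𝔸_F)`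
side finitely many pairwise distinct families `Bⱼ` of multisets of cardinality `n` with coefficients
`dⱼ`, among them `B_{j₀} = N(t_π)` (the base change `α ↦ α^{f(w|v)}` of a Satake family `α` of `π`
off `S`) with `d_{j₀} ≠ 0`.

It is the lifting-direction twin of the tree's descent-direction child
`ArthurClozel1989_traceIdentity_heckeCharacters` (`AutomorphicGaloisConjDecomposition.lean`,
Thm. 4.2 (d)) with the exceptional set PRESCRIBED, and it is — token for token — the hypothesis
`hTI` of the two ACCEPTED reductions
`ArthurClozel1989_strongLifting_cuspidal.of_heckeCharacterIdentity`
(`BaseChangeStrongCuspidalPrimeProofs.lean`) and, specialised to fixed `n F E`,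
`arthurClozel1989_weakLifting_cuspidal_offS_of_heckeCharacterIdentity`
(`ArthurClozelWeakLiftingOffSProofs.lean`).  Hence, granted this fact, the Jacquet–Shalika facts
(2.2)–(2.4) and (strong) multiplicity one for `GL_n`, the tree PROVES
`ArthurClozel1989_strongLifting_cuspidal` (and its deprecated alias
`ArthurClozel1989_cuspidalBaseChange_unramified`), `ArthurClozel1989_weakLifting_cuspidal_offS`,
`ArthurClozel1989_weakLifting_cuspidal` and clause (i) of
`ArthurClozel1989_strongLifting_unramified`: this is the ONE unproved analytic input (the twisted
trace formula and its stabilised comparison) behind those five debt entries (librarian sweep g39,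
promote events 4165369 / 4178374).

Design: a binder-free `def … : Prop` (census-trackable, dischargeable by name as
`ArthurClozel1989_liftingIdentity_heckeCharacters_holds`); all data universally quantified inside,
automorphic measures passed as parameters of the quantifier exactly as in the consumers.  Nothing is
proved here and no new notion is introduced.

## References

* J. Arthur, L. Clozel, *Simple algebras, base change, and the advanced theory of the trace
  formula*, Annals of Mathematics Studies 120, Princeton University Press, 1989 — Ch. 2, Thms. A, B,
  (17.8); Ch. 3, §1 (1.1), §2 (2.1)–(2.4), Thm. 3.1, (4.1), (4.2), Thm. 4.2 (a) and its proof,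
  pp. 201–205. [ArthurClozelAMS120]
* R. P. Langlands, *On the notion of an automorphic representation*, Proc. Sympos. Pure Math. 33,
  Part 1 (Corvallis 1977), AMS, 1979, 203–207 — Prop. 2. [LanglandsCorvallis1979Notion]
-/

noncomputable section

open scoped MatrixGroups
open NumberField IsDedekindDomain _root_.MeasureTheory Filter

namespace Literature.NumberTheory.Automorphic

open AdelicGroupData

/-- **Arthur–Clozel 1989, Ch. 3, (4.1) = (4.2) for a cuspidal `π` of `GL_n(𝔸_F)`, lifting direction,
off a prescribed `S` (named fact).**  For a Galois extension `E/F` of number fields of prime degree,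
`n ≥ 1`, an automorphic measure `μ` on `GL_n(𝔸_F)` and a family `ν_a` of automorphic measures on the
`GL_a(𝔸_E)`, a cuspidal automorphic representation `π ⊂ L²(μ)` and a finite set `S` of finite places
of `F` such that `E/F` and `π` are unramified off `S`: there are finitely many isobaric data over
`E` (coefficients `cᵢ`, ranks `k_{i,m} ≥ 1` with `∑ₘ k_{i,m} = n`, cuspidal
`Π_{i,m} ⊂ L²(ν_{k_{i,m}})`, shifts `s_{i,m}` with `∑ₘ k_{i,m} s_{i,m} = 0`, Satake families
`A_{i,m}` of the `Π_{i,m}` off the places of `E` over `S`) and finitely many families `Bⱼ` of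
multisets of cardinality `n` indexed by the places of `E` not over `S`, pairwise distinct there,
with coefficients `dⱼ`, one of which, `B_{j₀}` with `d_{j₀} ≠ 0`, is the base change
`w ↦ α(v)^{f(w|v)}` of a Satake family `α` of `π` off `S`, such that for every polynomial `φ`
in the Hecke operators `T_{w,i}` (`w` not over `S`, `1 ≤ i ≤ n`;
`χ_T(T_{w,i}) = q_w^{i(n-i)/2} e_i(T_w)`)
`∑ᵢ cᵢ χ_{⊞ₘ Π_{i,m}[s_{i,m}]}(φ) = ∑ⱼ dⱼ χ_{Bⱼ}(φ)`.
This is the comparison (4.1) = (4.2) of the trace formula for `GL_n(𝔸_F)` and the twisted trace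
formula for `GL_n(𝔸_E) ⋊ σ` (Ch. 2, Thms. A, B, (17.8)) for test functions `f = (f_S, b φ^S)`,
`φ = (φ_S, φ^S)` with `f_S` isolating `π_S` ("`∑ nᵢ trace πᵢ(f_S)` with `nᵢ > 0`, and can therefore
be made `≠ 0`", p. 205), the discrete terms on the twisted side written through their cuspidal data
(Langlands' Prop. 2; "occurring in (4.2) … a subquotient of `Π₁ × ⋯ × Π_r`", p. 205) and on the
`GL_n(𝔸_F)` side as independent characters of `b(ℋ_E^S)` (p. 204).  Verbatim the hypothesis `hTI` of
`ArthurClozel1989_strongLifting_cuspidal.of_heckeCharacterIdentity`; lifting twin of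
`ArthurClozel1989_traceIdentity_heckeCharacters`.
[cite: ArthurClozelAMS120, Ch. 3 (4.1) = (4.2), proof of Thm. 4.2 (a) pp. 203–205; Ch. 2 (17.8)]
[cite: LanglandsCorvallis1979Notion, Prop. 2] -/
def ArthurClozel1989_liftingIdentity_heckeCharacters : Prop :=
  ∀ {n : ℕ} {F E : Type} [Field F] [NumberField F] [Field E] [NumberField E]
    [Algebra F E] [IsGalois F E], (Module.finrank F E).Prime → 0 < n →
    ∀ (μ : Measure (gl n F).automorphicQuotient) [(gl n F).IsAutomorphicMeasure μ]
      (P : CuspidalAutomorphicRepGL n F μ)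
      (ν : (a : ℕ) → Measure (gl a E).automorphicQuotient)
      [∀ a, (gl a E).IsAutomorphicMeasure (ν a)]
      (S : Set (HeightOneSpectrum (𝓞 F))), S.Finite →
      (∀ v ∉ S, Algebra.IsUnramifiedIn (𝓞 E) v.asIdeal) →
      (∀ v ∉ S, IsUnramifiedAt P.1 v) →
      ∃ (a : ℕ) (c : Fin a → ℂ) (r : Fin a → ℕ) (k : (i : Fin a) → Fin (r i) → ℕ)
        (_ : ∀ i m, 0 < k i m) (_ : ∀ i, ∑ m, k i m = n)
        (Q : (i : Fin a) → (m : Fin (r i)) → CuspidalAutomorphicRepGL (k i m) E (ν (k i m)))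
        (s : (i : Fin a) → Fin (r i) → ℂ) (_ : ∀ i, ∑ m, (k i m : ℂ) * s i m = 0)
        (A : (i : Fin a) → Fin (r i) → SatakeFamily E)
        (_ : ∀ i m, IsSatakeFamilyOf (Q i m) {w | w.under (𝓞 F) ∈ S} (A i m))
        (b : ℕ) (d : Fin b → ℂ) (B : Fin b → SatakeFamily E)
        (_ : ∀ j, ∀ w ∉ {w : HeightOneSpectrum (𝓞 E) | w.under (𝓞 F) ∈ S},
          Multiset.card (B j w) = n)
        (_ : ∀ j j', (∀ w ∉ {w : HeightOneSpectrum (𝓞 E) | w.under (𝓞 F) ∈ S}, B j w = B j' w) →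
          j = j')
        (j₀ : Fin b) (_ : d j₀ ≠ 0)
        (α : SatakeFamily F) (_ : IsSatakeFamilyOf P S α)
        (_ : ∀ w ∉ {w : HeightOneSpectrum (𝓞 E) | w.under (𝓞 F) ∈ S},
          B j₀ w = (α (w.under (𝓞 F))).map (· ^ w.asIdeal.inertiaDeg (𝓞 F))),
        ∀ φ : MvPolynomial
            ({w : HeightOneSpectrum (𝓞 E) //
                w ∉ {w : HeightOneSpectrum (𝓞 E) | w.under (𝓞 F) ∈ S}} × Fin n) ℂ,
          ∑ i, c i * MvPolynomial.eval
              (fun p : {w : HeightOneSpectrum (𝓞 E) //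
                  w ∉ {w : HeightOneSpectrum (𝓞 E) | w.under (𝓞 F) ∈ S}} × Fin n =>
                ((Real.sqrt (p.1.1.residueCard : ℝ) : ℝ) : ℂ) ^ ((p.2.1 + 1) * (n - (p.2.1 + 1))) *
                  (∑ m, (A i m p.1.1).map (((p.1.1.residueCard : ℂ) ^ (-(s i m))) * ·)).esymm
                    (p.2.1 + 1)) φ =
            ∑ j, d j * MvPolynomial.eval
              (fun p : {w : HeightOneSpectrum (𝓞 E) //
                  w ∉ {w : HeightOneSpectrum (𝓞 E) | w.under (𝓞 F) ∈ S}} × Fin n =>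
                ((Real.sqrt (p.1.1.residueCard : ℝ) : ℝ) : ℂ) ^ ((p.2.1 + 1) * (n - (p.2.1 + 1))) *
                  (B j p.1.1).esymm (p.2.1 + 1)) φ

end Literature.NumberTheory.Automorphic

end
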